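import Literature.Barriers.QuantumAdvantage.PPolyOracles
import Literature.Barriers.QuantumAdvantage.AaronsonChenOracle
import Literature.Computability.Cryptography.PseudorandomPermutations
import Literature.Computability.Cryptography.LubyRackoff
import Literature.Computability.Cryptography.OracleAdversaryPrecomp
import Literature.Computability.QuantumComplexity.CountingSimulationRel
import Literature.Computability.Cryptography.Pseudorandomness
import Literature.Computability.Cryptography.StatisticalDistanceProofs
import Literature.Computability.Complexity.BrickAlgebra
import Literature.Computability.Complexity.CookReducibilityTransitive
import HarnessLib
import Summits.PneNP.PneNP.Theorems.OWFExist

/-!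
# Barrier `PPolyOracles` (Aaronson–Chen 2017, Thms. 7.6 and 8.1): decomposition towards `PPolyOracles_holds`

Sibling proof file of `Literature/Barriers/QuantumAdvantage/PPolyOracles.lean` (D-0014: the fact
`Literature.Barriers.QuantumAdvantage.PPolyOracles = aaronsonChen2017_thm76 ∧ aaronsonChen2017_thm81`
stays a `def`; this file works towards `PPolyOracles_holds`). Both conjuncts are theorems in
print whose proofs are theories in the tree's machine models; following the pattern of
`AaronsonChenOracle.lean` (Cor. 5.2) this file vendors the printed INTERMEDIATE results as named
facts in the tree's models and PROVES the reductions between them, so that what remains is an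
explicit list of leaves (module-end summary).

**The printed proofs** (S. Aaronson, L. Chen, CCC 2017, arXiv:1612.05903 [AaronsonChen2017],
read via `lit read arxiv:1612.05903`, pp. 29–33).

* **Thm. 7.6** (p. 30): "Assuming one-way functions exist, there exists an oracle `O ∈ P/poly`
  such that `BPP^O ≠ BQP^O`." Proof architecture: **Lemma 7.4** ([HILL], [GGM], [Goldreich–Levin 1989,
  hard-core predicate], [Luby–Rackoff]): "If one-way functions exist, then there exist secure PRFs and PRPs"; §7.2:
  "by Lemma 7.4, let `PRP^raw` be a secure pseudorandom permutation", Zhandry's modification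
  `PRF^mod_{(k,a)}(x) = PRP^raw_k((x − 1) mod a + 1)` (`a` a prime in `[√N/4, √N/2]`) and
  **Lemma 7.5** (classically `PRP^raw`, `PRF^mod` are indistinguishable; quantumly they are
  distinguishable with advantage `1 − negl`, by period finding); proof of Thm. 7.6: a RANDOM
  oracle encoding `f_1, f_2, …`, `f_n ← PRP^raw_K` or `← PRF^mod_K` with probability `½` each,
  `L = {0ⁿ : f_n from PRP^raw}`; `L ∈ BQP^O` with probability `1` (Borel–Cantelli, hard-wiring),
  `L ∉ BPP^O` with probability `1` (each machine is right on `0ⁿ` with probability `½ + o(1)`;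
  countably many machines); "each `f_n` has a polynomial-size circuit, and consequently
  `O ∈ P/poly`."
* **Thm. 8.1** (p. 32): "Suppose `SampBPP = SampBQP` and `NP ⊆ BPP`. Then for every oracle
  `O ∈ P/poly`, we have `SampBPP^O = SampBQP^O` (and consequently `BPP^O = BQP^O`)." Proof
  architecture: **Lemma 8.2** (same hypotheses; for every polynomial `q` and every `SampBQP`
  oracle algorithm `M` there is a `SampBPP` oracle algorithm `A` with
  `‖𝒟^M_{x,ε} − 𝒟^A_{x,ε}‖ ≤ ε` for EVERY `O ∈ SIZE(q(n))`; PAC learning of the oracle gates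
  under `NP ⊆ BPP`, simulation of the rest under `SampBPP = SampBQP`); proof of Thm. 8.1 from
  Lemma 8.2: `O ∈ P/poly ⇒ O ∈ SIZE(q)`; run `A_M` on `⟨x, 0^{2/ε}⟩`; triangle inequality;
  "Hence `SampBQP^O ⊆ SampBPP^O`" (the reverse inclusion and "consequently `BPP^O = BQP^O`"
  are tacit).

**What this file adds.**

* Named facts (leaves), each in the tree's models: `aaronsonChen2017_thm76_of_prp`
  (`PRPExist → PPolyOracleSeparation`, the content of §7.2–7.3), `aaronsonChen2017_lem82`
  (Lemma 8.2, quantitative and uniform over `SIZE(q)`, typed like the sibling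
  `aaronsonChen2017_lem53`), `aaronsonChen2017_thm81_sampBQP_subset` ("Hence
  `SampBQP^O ⊆ SampBPP^O`") and the sampling-to-language bridge
  `BQPRel_subset_BPPRel_of_sampBQPRel_subset` ("consequently"). The other two bridges are tree
  facts: `SampPRel_subset_SampBQPRel` (`AaronsonChenOracle.lean`) and
  `Literature.Computability.QuantumComplexity.BPPRel_ofLanguage_subset_BQPRel`
  (Bernstein–Vazirani Thm. 8.3 relativized, `QuantumComplexity/CountingSimulationRel.lean`).
* PROVED reductions: `aaronsonChen2017_lem74` (Lemma 7.4, "if one-way functions exist, then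
  there exist secure PRFs and PRPs", `OWFExist → PRFExist ∧ PRPExist`, from the tree facts HILL
  `PRGExist_iff_OWFExist`, GGM `PRFExist_of_PRGExist` and Luby–Rackoff `PRPExist_of_PRFExist` —
  the paper's own citation list; alias `aaronsonChen2017_lem74_of_parts`; see Revision 4),
  `aaronsonChen2017_thm76_of_parts`, `exists_SIZE_of_mem_PPoly`, `doubleAccuracy_boolPair`,
  `doubleAccuracy_mem_FP` (the re-encoding `⟨x, 1^k⟩ ↦ ⟨x, 1^{2k}⟩` is polynomial-time, from
  the tree's brick algebra: `fanoutFn`, `fstF`, `sndF`, `concatFn`),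
  `aaronsonChen2017_thm81_sampBQP_subset_of_lem82` (Thm. 8.1's printed `ε/2` argument from
  Lemma 8.2 ALONE: the machine `A'` comes from the proved closure of PPT oracle adversaries
  under polynomial-time preprocessing, `OracleAdversary.exists_ppt_outputPMF_precomp` of
  `Cryptography/OracleAdversaryPrecomp.lean`, and the triangle inequality is the discharged
  `PMF.tvDist_triangle_holds`), `aaronsonChen2017_thm81_of_parts`,
  `aaronsonChen2017_thm81_of_lem82`, and the assemblies `PPolyOracles_of_parts`,
  `PPolyOracles_of_leaves`.

**Revision 2 (provefact audit of the technique class `PPolyOracleSamplingSeparation`).** The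
entry file's `PPolyOracleSamplingSeparation` (`∃ O ∈ P/poly, SampBPP^O ≠ SampBQP^O`,
unconditionally) is the TECHNIQUE CLASS of the barrier, not a result in print: the source
asserts it only under one-way functions (§1, p. 10: "Relative to some efficiently computable
oracle, we can prove `SampBPP ≠ SampBQP`, but only under a weak computational assumption, like
the existence of one-way functions"; Thm. 7.6 is the language form) and proves that an
unconditional proof needs an unrelativized class separation (Thm. 8.1; §8, p. 32: "It is
therefore natural to ask whether we can prove the same statements unconditionally. In this
section, we show that at least some complexity assumptions are needed"). This revision PROVES:
a language separation relative to `O` is a sampling separation relative to `O`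
(`pPolyOracleSamplingSeparation_of_pPolyOracleSeparation`, from the two bridges), the printed
conditional `OWFExist → PPolyOracleSamplingSeparation` from Thm. 7.6 and from the leaves
(`aaronsonChen2017_thm76_samp_of_parts`, `aaronsonChen2017_thm76_samp_of_leaves`,
`pPolyOracleSamplingSeparation_of_owf`), the refutation of the technique class under the
collapse hypotheses of Thm. 8.1 (`not_pPolyOracleSamplingSeparation_of_collapse`,
`sampP_ne_or_NP_not_subset_of_samplingSeparation`) and its reformulation as the failure of
`SampBQP^O ⊆ SampBPP^O` for some `O ∈ P/poly` (`pPolyOracleSamplingSeparation_iff_not_subset`).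
So `PPolyOracleSamplingSeparation_holds` is out of reach exactly as the source says: from the
leaves it follows from `OWFExist` (`aaronsonChen2017_thm76_samp_of_leaves`), and unconditionally
it would refute `SampP = SampBQP ∧ NP ⊆ BPP` (`sampP_ne_or_NP_not_subset_of_samplingSeparation`).

**Revision 3 (provefact `aaronsonChen2017_lem74`, decomposition of the Luby–Rackoff leaf).** Lemma 7.4
is a citation lemma ("Lemma 7.4 ([HILL99, GGM86, GL89, LR88])", GL89 = Goldreich–Levin 1989, the
hard-core predicate, an ingredient internal to the HILL step and hence subsumed by the tree's
`PRGExist_iff_OWFExist` leaf; the paper prints no proof), so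
a discharge of Lemma 7.4 is the conjunction of three theories in the tree's machine models.
The Luby–Rackoff leaf `PRPExist_of_PRFExist` is now opened one layer:
`Literature/Computability/Cryptography/LubyRackoff.lean` vendors Goldreich's Construction 3.7.6
(`feistelEnsemble F = DES³_F`) with the permutation and efficiency clauses of Thm. 3.7.7 PROVED and
the security clause as the named fact `LubyRackoff1988_feistel3`, and proves
`PRPExist_of_PRFExist_of_feistel3`; `aaronsonChen2017_lem74_of_parts_feistel3` below is Lemma 7.4
from HILL, GGM and that security clause. (The GGM leaf is opened likewise in `GGM.lean`:
`PRFExist_of_exists_isPRG_succ` from `GGM1986_thm3` and `exists_isPRG_of_stretch_succ`, for a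
one-bit-stretch PRG.)

**Revision 4 (D-0026 review of the decomposition: Lemma 7.4 merged back).** Revisions 1 and 3
carried Lemma 7.4 as a separate named fact (the `Prop`-valued definition `aaronsonChen2017_lem74`
with body `OWFExist → PRFExist ∧ PRPExist`) with a discharge obligation of its own, and its
prove-seat sized that obligation as a theory. The review of the cut, with the source open (p. 29: "It is
well-known that the existence of one-way functions implies the existence of PRFs and PRPs.
Lemma 7.4 ([HILL99, GGM86, GL89, LR88]). …" — a citation, no proof printed), found it mis-cut:
the lemma's ENTIRE obligation is the conjunction of three results the tree already names as
facts of `Literature/Computability/Cryptography/` — HILL `PRGExist_iff_OWFExist`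
(`Pseudorandomness.lean`; its `→` direction is the tree theorem `OWFExist_of_PRGExist`, its `←`
direction the HILL construction), GGM `PRFExist_of_PRGExist` (meanwhile discharged:
`PRFExist_of_PRGExist_holds`, `PseudorandomnessPRFProofs.lean`) and Luby–Rackoff
`PRPExist_of_PRFExist` (`PseudorandomPermutations.lean`; reduced through `LubyRackoff.lean` and
`LubyRackoffIdeal.lean` to `LubyRackoff.HybridStep` and the discharged `LubyRackoff.MainLemma_holds`)
— from which `aaronsonChen2017_lem74_of_parts` proved it in three lines. A discharge
`aaronsonChen2017_lem74_holds` could only ever be that composition applied to those facts'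
discharges, so the separate fact restated existing obligations without adding a provable
statement. This revision MERGES it back: `aaronsonChen2017_lem74` is now the PROVED reduction
(same name, same cite; hypotheses = the three cited facts; `aaronsonChen2017_lem74_of_parts` kept
as its alias for importers), `aaronsonChen2017_thm76_of_parts` and `PPolyOracles_of_parts` take
Lemma 7.4 as the printed implication `OWFExist → PRFExist ∧ PRPExist`, and no other declaration
changes its statement (`aaronsonChen2017_thm76_of_parts'`, `PPolyOracles_of_leaves`, … keep their
types). What stands behind Lemma 7.4 is thereby exactly the pre-existing facts
`PRGExist_iff_OWFExist` and `LubyRackoff.HybridStep`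
(`PPolyOraclesAssembly.aaronsonChen2017_lem74_of_frontier₂`). No definition and no named fact is
added.

**Revision 5 (D-0026 review of the decomposition: the sampling form of Thm. 7.6 merged back).**
Revision 2 had also minted the printed conditional as a separate named fact
`aaronsonChen2017_thm76_samp` (the `Prop`-valued definition with body
`OWFExist → PPolyOracleSamplingSeparation`), a decomposition child whose prove-seat then sized it
XL. The review of the cut, with the source open (§1 p. 10, ll. 1–7; Thm. 7.6, p. 30, ll. 16–41:
the printed theorem is the LANGUAGE form, the sampling form is the §1 summary sentence), found it
mis-cut: the statement is faithful, but it is no PART of any printed proof — it is a COROLLARY of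
the sibling fact `aaronsonChen2017_thm76` (Thm. 7.6 as printed) through the two model bridges `h₃`
(`BPPRel_ofLanguage_subset_BQPRel`) and `h₄` (`BQPRel_subset_BPPRel_of_sampBQPRel_subset`), and
both bridges are meanwhile tree THEOREMS
(`Literature.Computability.QuantumComplexity.BPPRel_ofLanguage_subset_BQPRel_holds`,
`QuantumComplexity/CountingSimulationRelProofs.lean`;
`BQPRel_subset_BPPRel_of_sampBQPRel_subset_holds`, `PPolyOraclesSampToLanguage.lean`). Its entire
proof obligation therefore coincided with `aaronsonChen2017_thm76_holds` and, as a separate fact,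
double-counted that debt. This revision MERGES it back: the `def` is retired — no statement of the
source is lost, the §1 p. 10 sentence being the theorem
`pPolyOracleSamplingSeparation_of_thm76 : aaronsonChen2017_thm76 → OWFExist → PPolyOracleSamplingSeparation`
of `PPolyOraclesBridgesProofs.lean` (all bridges discharged) — and the theorems that concluded it
keep their names with the unfolded conclusion `OWFExist → PPolyOracleSamplingSeparation` (here
`aaronsonChen2017_thm76_samp_of_parts`, `aaronsonChen2017_thm76_samp_of_leaves`; likewise in
`PPolyOraclesBridges.lean` and `PPolyOraclesBridgesProofs.lean`). The one open leaf of the sampling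
form is `aaronsonChen2017_thm76` (decomposed in `PPolyOraclesThm76.lean`, assembled in
`PPolyOraclesAssembly.lean`). No definition and no named fact is added.

## Design notes

* Models as in the entry file and its siblings: `OWFExist` (uniform PPT inverters; the paper's
  classical one-way functions — uniform security suffices for Thm. 7.6, analysing the BPP side
  along a sparse sequence of input lengths), `PRFExist`/`PRPExist`
  (`PseudorandomFunctions.lean`, `PseudorandomPermutations.lean`), `SampPRel`/`SampBQPRel`
  (`SupremacyTheoremsNonRelativizing.lean`), `SIZE`/`PPoly` (G01 `CircuitClasses.lean`).
* `aaronsonChen2017_thm76_of_prp` packages §7.2 (Zhandry's construction from ANY classically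
  secure PRP), Lemma 7.5 and the random-oracle argument of the proof of Thm. 7.6; its further
  decomposition needs the objects `PRP^raw`, `PRF^mod` and a measure on oracles (future work,
  tracked in the prover's NOTES).
* The accuracy convention of the tree's sampling classes is `ε = 1/k`, input `⟨x, 1^k⟩`
  (`boolPair x (unaryEncodeNat k)`); the paper's "run `A_M` on `⟨x, 0^{2/ε}⟩`" is the
  re-encoding `doubleAccuracy : ⟨x, 1^k⟩ ↦ ⟨x, 1^{2k}⟩`, proved polynomial-time here with the
  tree's string bricks (`BrickAlgebra.lean`, `StringEquality.lean`,
  `CookReducibilityTransitive.lean`: `doubleAccuracy = fanoutFn fstF (concatFn ∘ fanoutFn sndF sndF)`)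
  and fed to `OracleAdversary.exists_ppt_outputPMF_precomp` (exact output law of "run `𝒜` on
  `g w`" for every deterministic oracle).

## What remains for `PPolyOracles_holds`

The eight hypotheses of `PPolyOracles_of_leaves`: `PRGExist_iff_OWFExist` (HILL),
`PRFExist_of_PRGExist` (GGM; `GGM.lean` reduces it to `GGM1986_thm3`), `PRPExist_of_PRFExist`
(Luby–Rackoff; `LubyRackoff.lean` reduces it to `LubyRackoff1988_feistel3`, Revision 3), `aaronsonChen2017_thm76_of_prp` (§7.2–7.3: Zhandry's Lemma 7.5 and the
random-oracle argument), `aaronsonChen2017_lem82` (PAC-learning simulation),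
`SampPRel_subset_SampBQPRel`, `Literature.Computability.QuantumComplexity.BPPRel_ofLanguage_subset_BQPRel`
(unrelativized form discharged as `BPP_subset_BQP_holds`) and
`BQPRel_subset_BPPRel_of_sampBQPRel_subset` — each a theory-sized formalization in the tree's
machine models. (State at Revision 4, for orientation only — the live frontier is assembled in
`PPolyOraclesAssembly.lean`: discharged in sibling files since this list was written are GGM
`PRFExist_of_PRGExist_holds`, `aaronsonChen2017_lem82_holds` and the whole Thm. 8.1 conjunct
`aaronsonChen2017_thm81_holds` (`PPolyOraclesLemma82Proofs.lean`, vacuously over the tree's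
advice-taking `SampP`, as recorded there), `SampPRel_subset_SampBQPRel_holds`
(`SampPRelSubsetSampBQPRelHolds.lean`), `BPPRel_ofLanguage_subset_BQPRel_holds`
(`QuantumComplexity/CountingSimulationRelProofs.lean`) and
`BQPRel_subset_BPPRel_of_sampBQPRel_subset_holds` (`PPolyOraclesSampToLanguage.lean`); HILL
`PRGExist_iff_OWFExist`, the Luby–Rackoff hybrid step `LubyRackoff.HybridStep` and the leaves of
`aaronsonChen2017_thm76_of_prp` opened in `PPolyOraclesThm76.lean`/`PPolyOraclesPPoly.lean` are not.)

## Sources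

* [AaronsonChen2017] arXiv:1612.05903: §7.1 (Def. 7.1–7.3, Lemma 7.4, p. 29), §7.2 (Zhandry's
  construction, Lemma 7.5, pp. 29–30), Thm. 7.6 and its proof (p. 30), Thm. 8.1, Lemma 8.2 and
  the proof of Thm. 8.1 from Lemma 8.2 (p. 32).
* [BernsteinVazirani1997SICOMP] E. Bernstein, U. Vazirani, *Quantum complexity theory*, SIAM J.
  Comput. 26 (1997), Thm. 8.3 (`BPP ⊆ BQP`, p. 1451) and §8.3 (oracle QTMs) (held, read via
  `lit read doi:10.1145/167088.167097`, PDF pp. 41, 43–44).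
* [LubyRackoff1988], [GoldreichGoldwasserMicali1986], [HastadImpagliazzoLevinLuby1999] through the
  tree facts `PRPExist_of_PRFExist`, `PRFExist_of_PRGExist`, `PRGExist_iff_OWFExist`.
* Revision 2: [AaronsonChen2017] §1 (p. 9, ll. 40–84; p. 10, ll. 1–7, "smooth tradeoff"), §8 (p. 32,
  ll. 1–8), re-read via `lit read arxiv:1612.05903` (arXiv PDF pages).
* Revision 3: [AaronsonChen2017] §7.1, Lemma 7.4 (p. 29, re-read: "Lemma 7.4 ([HILL99, GGM86,
  GL89, LR88]). If one-way functions exist, then there exist secure PRFs and PRPs." — HILL99 =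
  Håstad–Impagliazzo–Levin–Luby 1999, GGM86 = Goldreich–Goldwasser–Micali 1986, GL89 =
  Goldreich–Levin 1989, "A hard-core predicate for all one-way functions" (STOC 1989), LR88 =
  Luby–Rackoff 1988); [Goldreich2001] §3.7, Construction 3.7.6 and Thm. 3.7.7 (held 2004
  printing, pp. 202–203) through `LubyRackoff.lean`.
* Revision 4: [AaronsonChen2017] §7.1, p. 29, re-read via `lit read arxiv:1612.05903` (the
  sentence "It is well-known that the existence of one-way functions implies the existence of
  PRFs and PRPs." immediately preceding Lemma 7.4, and the lemma with its citation list; no proof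
  is printed); the tree files `Cryptography/Pseudorandomness.lean` (`PRGExist_iff_OWFExist`,
  `PRFExist_of_PRGExist`), `Cryptography/PseudorandomPermutations.lean` (`PRPExist_of_PRFExist`),
  `Cryptography/PseudorandomnessPRFProofs.lean`, `Cryptography/LubyRackoffIdeal.lean`,
  `Cryptography/LubyRackoffIdealProofs.lean` and `PPolyOraclesAssembly.lean` for the status of the
  three cited facts.
* Revision 5: [AaronsonChen2017] §1.3 (p. 10, ll. 1–7) and Thm. 7.6 with its proof (p. 30,
  ll. 16–41), re-read via `lit read arxiv:1612.05903` for the review of the cut; the tree files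
  `QuantumComplexity/CountingSimulationRelProofs.lean` (`BPPRel_ofLanguage_subset_BQPRel_holds`),
  `PPolyOraclesSampToLanguage.lean` (`BQPRel_subset_BPPRel_of_sampBQPRel_subset_holds`) and
  `PPolyOraclesBridgesProofs.lean` (`pPolyOracleSamplingSeparation_of_thm76`) for the bridges.
-/

noncomputable section

namespace Literature.Barriers.QuantumAdvantage

open _root_.Computability Literature.Computability.Complexity Literature.Computability.Complexity.Classes Literature.Computability.Complexity.Nondeterministic Literature.Computability.Cryptography
open Literature.Computability.Complexity.Brick Literature.Computability.Complexity.OracleCompose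
open Literature.Computability.QuantumComplexity (BPPRel_ofLanguage_subset_BQPRel)

/-! ### Theorem 7.6: the parts -/

/-- **Aaronson–Chen 2017, Lemma 7.4** (first sentence; "[HILL99, GGM86, GL89, LR88]" = HILL, GGM,
Goldreich–Levin 1989 (hard-core predicate), Luby–Rackoff): "If one-way functions exist, then there
exist secure PRFs and PRPs" — the printed implication `OWFExist → PRFExist ∧ PRPExist` over the
tree's `OWFExist`, `PRFExist`, `PRPExist` (all classical and uniform: "these are all purely
classical assumptions, which make no reference to quantum algorithms"), PROVED from the tree's
named facts for exactly the cited results: HILL `PRGExist_iff_OWFExist` (only its `←` direction is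
used), GGM `PRFExist_of_PRGExist`, Luby–Rackoff `PRPExist_of_PRFExist` (all of
`Literature/Computability/Cryptography/`). The paper prints no proof ("It is well-known that the
existence of one-way functions implies the existence of PRFs and PRPs", p. 29), so Lemma 7.4
carries no proof obligation of its own: it is a reduction to those three facts and is stated as
such (Revision 4 of the module docstring: formerly a separate named fact `def … : Prop`, merged
back by the D-0026 review of the decomposition). The second sentence (subexponentially secure
one-way functions give exponentially secure PRFs) is not vendored (no consumer; the tree has no
subexponential-security notions). [cite: AaronsonChen2017, Lemma 7.4 (p. 29)] -/
theorem aaronsonChen2017_lem74 (h₁ : PRGExist_iff_OWFExist) (h₂ : PRFExist_of_PRGExist)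
    (h₃ : PRPExist_of_PRFExist) : Summit.PneNP.PneNP.OWFExist → PRFExist ∧ PRPExist := fun howf =>
  have hprf : PRFExist := h₂ (h₁.2 howf)
  ⟨hprf, h₃ hprf⟩

/-- **Aaronson–Chen 2017, §7.2–7.3: a classically secure PRP yields an oracle `O ∈ P/poly` with
`BPP^O ≠ BQP^O`.** From any secure pseudorandom permutation `PRP^raw` ("by Lemma 7.4, let
`PRP^raw` be a secure pseudorandom permutation", §7.2), Zhandry's `PRF^mod` and Lemma 7.5 give
the random oracle of the proof of Thm. 7.6, relative to which `BPP ≠ BQP` with probability `1`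
while every sample is in `P/poly`. Over the tree's `PRPExist` and the technique class
`PPolyOracleSeparation` of the entry file.
[cite: AaronsonChen2017, §7.2, Lemma 7.5 and proof of Thm. 7.6 (pp. 29–30)] -/
def aaronsonChen2017_thm76_of_prp : Prop :=
  PRPExist → PPolyOracleSeparation

/-! ### Theorem 8.1: the parts -/

/-- **Aaronson–Chen 2017, Lemma 8.2** (the PAC-learning simulation lemma), in the tree's models
(compare `aaronsonChen2017_lem53`): suppose `SampBPP = SampBQP` and `NP ⊆ BPP`; then for every
polynomial `q` and every `SampBQP` oracle algorithm — a poly-time uniform Clifford+T family `F`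
with oracle gates and a polynomial-time post-processing `post` — there is a `SampBPP` oracle
algorithm `𝒜` (a PPT oracle adversary) such that for EVERY oracle language `O ∈ SIZE(q)`, every
input `x` and accuracy `ε = 1/k`, the output distributions of `F, post` and of `𝒜` on
`⟨x, 1^k⟩`, run with the oracle `O`, are within total variation distance `ε`.
[cite: AaronsonChen2017, Lemma 8.2 (p. 32)] -/
def aaronsonChen2017_lem82 : Prop :=
  SampP = SampBQP → NP ⊆ BPP →
    ∀ (q : Polynomial ℕ) (F : QCircuitFamily cliffordT) (post : List Bool → List Bool),
      F.IsUniform →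
      PolyTimeComputable (id : List Bool → List Bool) (id : List Bool → List Bool) post →
      ∃ 𝒜 : OracleAdversary (List Bool), 𝒜.IsPPT (encodingList Bool) ∧
        ∀ O : Language Bool, O ∈ SIZE (fun n => q.eval n) → ∀ (x : List Bool) (k : ℕ), 0 < k →
          ((F.kernel O (boolPair x (unaryEncodeNat k))).map post).tvDist
              (PMF.map (fun o => o.getD [])
                (𝒜.outputPMF (Oracle.ofLanguage O) (boolPair x (unaryEncodeNat k)))) ≤
            1 / (k : ℝ)

/-- **Aaronson–Chen 2017, proof of Thm. 8.1, printed conclusion**: "Hence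
`SampBQP^O ⊆ SampBPP^O`" for every `O ∈ P/poly`, under `SampBPP = SampBQP` and `NP ⊆ BPP`.
[cite: AaronsonChen2017, Thm. 8.1 (proof from Lemma 8.2, p. 32)] -/
def aaronsonChen2017_thm81_sampBQP_subset : Prop :=
  SampP = SampBQP → NP ⊆ BPP → ∀ O : Language Bool, O ∈ PPoly →
    SampBQPRel O ⊆ SampPRel (Oracle.ofLanguage O)

/-- **"and consequently `BPP^O = BQP^O`"** (the step from sampling to languages in Thm. 8.1): if
every `SampBQP^A` problem is in `SampBPP^A` then `BQP^A ⊆ BPP^A` — the output bit of a `BQP^A`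
family is a `SampBQP^A` problem (pad the accuracy parameter away uniformly), a classical sampler
within total variation `1/12` of it decides with error `< 1/2 − 1/12`, and majority voting
restores the `2/3` threshold of `bp (P^A)`. Model bridge between Q2 uniform families, C4a oracle
adversaries and the G01 transcript model, stated as a named fact.
[cite: AaronsonChen2017, Thm. 8.1 ("and consequently BPP^O = BQP^O", p. 32)] -/
def BQPRel_subset_BPPRel_of_sampBQPRel_subset : Prop :=
  ∀ A : Language Bool, SampBQPRel A ⊆ SampPRel (Oracle.ofLanguage A) →
    BQPRel A ⊆ BPPRel (Oracle.ofLanguage A)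

/-! ### Theorem 7.6: the reductions (proved) -/

/-- **Lemma 7.4 from the tree's crypto facts** (the name under which importers consume
`aaronsonChen2017_lem74`, e.g. `PPolyOraclesAssembly.aaronsonChen2017_lem74_of_frontier₂`): HILL
(`PRGExist_iff_OWFExist`), GGM (`PRFExist_of_PRGExist`) and Luby–Rackoff (`PRPExist_of_PRFExist`)
compose to `OWFExist → PRFExist ∧ PRPExist` — the paper's own citation list for Lemma 7.4.
[cite: AaronsonChen2017, Lemma 7.4 (p. 29)] -/
theorem aaronsonChen2017_lem74_of_parts (h₁ : PRGExist_iff_OWFExist) (h₂ : PRFExist_of_PRGExist)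
    (h₃ : PRPExist_of_PRFExist) : Summit.PneNP.PneNP.OWFExist → PRFExist ∧ PRPExist :=
  aaronsonChen2017_lem74 h₁ h₂ h₃

/-- **Thm. 7.6 from its parts**: one-way functions give a secure PRP (Lemma 7.4, as the printed
implication `OWFExist → PRFExist ∧ PRPExist`), and a secure PRP gives the `P/poly` oracle
separating `BPP` from `BQP` (§7.2–7.3). [cite: AaronsonChen2017, Thm. 7.6 (proof, p. 30)] -/
theorem aaronsonChen2017_thm76_of_parts (h₁ : Summit.PneNP.PneNP.OWFExist → PRFExist ∧ PRPExist)
    (h₂ : aaronsonChen2017_thm76_of_prp) : aaronsonChen2017_thm76 := fun howf =>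
  h₂ (h₁ howf).2

/-- Hence Thm. 7.6 from the three crypto facts and the §7.2–7.3 fact.
[cite: AaronsonChen2017, Thm. 7.6 (proof, p. 30)] -/
theorem aaronsonChen2017_thm76_of_parts' (h₁ : PRGExist_iff_OWFExist) (h₂ : PRFExist_of_PRGExist)
    (h₃ : PRPExist_of_PRFExist) (h₄ : aaronsonChen2017_thm76_of_prp) : aaronsonChen2017_thm76 :=
  aaronsonChen2017_thm76_of_parts (aaronsonChen2017_lem74 h₁ h₂ h₃) h₄

/-! ### Theorem 8.1: the reductions (proved) -/

/-- "Let `O ∈ P/poly` be an oracle. Then there exists a polynomial `q(n)` such that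
`O ∈ SIZE(q(n))`" (first line of the proof of Thm. 8.1; definitional for the tree's `PPoly`).
[cite: AaronsonChen2017, Thm. 8.1 (proof, p. 32)] -/
theorem exists_SIZE_of_mem_PPoly {O : Language Bool} (hO : O ∈ PPoly) :
    ∃ q : Polynomial ℕ, O ∈ SIZE (fun n => q.eval n) :=
  Set.mem_iUnion.1 hO

/-- The re-encoding `⟨x, 1^k⟩ ↦ ⟨x, 1^{2k}⟩` of the accuracy parameter ("given input
`⟨x, 0^{1/ε}⟩`, run `A_M` on input `⟨x, 0^{2/ε}⟩`"): unpair, duplicate the second component,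
pair again (junk on ill-formed inputs, through `boolUnpair`).
[cite: AaronsonChen2017, Thm. 8.1 (proof, p. 32)] -/
def doubleAccuracy (w : List Bool) : List Bool :=
  boolPair (boolUnpair w).1 ((boolUnpair w).2 ++ (boolUnpair w).2)

/-- `1^k 1^k = 1^{2k}` for Mathlib's unary encoding. [folklore] -/
theorem unaryEncodeNat_append_self (k : ℕ) :
    unaryEncodeNat k ++ unaryEncodeNat k = unaryEncodeNat (2 * k) := by
  have h : ∀ n, unaryEncodeNat n = List.replicate n true := by
    intro n
    induction n with
    | zero => rfl
    | succ n ih => simp [unaryEncodeNat, ih, List.replicate_succ]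
  rw [h, h, ← List.replicate_add, two_mul]

/-- `doubleAccuracy ⟨x, 1^k⟩ = ⟨x, 1^{2k}⟩`. [cite: AaronsonChen2017, Thm. 8.1 (proof, p. 32)] -/
@[simp] theorem doubleAccuracy_boolPair (x : List Bool) (k : ℕ) :
    doubleAccuracy (boolPair x (unaryEncodeNat k)) = boolPair x (unaryEncodeNat (2 * k)) := by
  simp [doubleAccuracy, unaryEncodeNat_append_self]

/-- `doubleAccuracy` in the tree's string-brick algebra: pair the first projection with the
concatenation of two copies of the second. [folklore] -/
theorem doubleAccuracy_eq_bricks :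
    doubleAccuracy = fanoutFn fstF (concatFn ∘ fanoutFn sndF sndF) := by
  funext z
  simp [doubleAccuracy, fstF, sndF]

/-- **The re-encoding `⟨x, 1^k⟩ ↦ ⟨x, 1^{2k}⟩` is polynomial-time** (`∈ FP`), by the closure of
`FP` under fan-out, composition and concatenation (tree bricks `fanoutFn_mem_FP`, `comp_mem_FP`,
`concatFn_mem_FP`, `fstF_mem_FP`, `sndF_mem_FP`). [folklore] -/
theorem doubleAccuracy_mem_FP : doubleAccuracy ∈ FP := by
  rw [doubleAccuracy_eq_bricks]
  exact fanoutFn_mem_FP fstF_mem_FP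
    (comp_mem_FP concatFn_mem_FP (fanoutFn_mem_FP sndF_mem_FP sndF_mem_FP))

/-- The same as a `PolyTimeComputable` statement (the form
`OracleAdversary.exists_ppt_outputPMF_precomp` consumes). [folklore] -/
theorem polyTimeComputable_doubleAccuracy :
    PolyTimeComputable (id : List Bool → List Bool) (id : List Bool → List Bool) doubleAccuracy :=
  doubleAccuracy_mem_FP

/-- **Thm. 8.1's inclusion from Lemma 8.2** (the printed `ε/2` argument): for `O ∈ P/poly` pick
`q` with `O ∈ SIZE(q)`; a problem `S ∈ SampBQP^O` comes with `(F, post)`; Lemma 8.2 gives `𝒜`;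
the machine `A'` running `𝒜` on `⟨x, 1^{2k}⟩` (the proved preprocessing closure
`OracleAdversary.exists_ppt_outputPMF_precomp` with the polynomial-time `doubleAccuracy`) is
within `1/(2k) + 1/(2k) = 1/k` of `S_x` by the triangle inequality (`PMF.tvDist_triangle_holds`).
[cite: AaronsonChen2017, Thm. 8.1 (proof from Lemma 8.2, p. 32)] -/
theorem aaronsonChen2017_thm81_sampBQP_subset_of_lem82 (h82 : aaronsonChen2017_lem82) :
    aaronsonChen2017_thm81_sampBQP_subset := by
  intro hS hNP O hO S hSmem
  obtain ⟨q, hq⟩ := exists_SIZE_of_mem_PPoly hO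
  obtain ⟨F, post, hU, hpost, hacc⟩ := hSmem
  obtain ⟨𝒜, h𝒜, hsim⟩ := h82 hS hNP q F post hU hpost
  obtain ⟨𝒜', h𝒜', hrun⟩ := 𝒜.exists_ppt_outputPMF_precomp h𝒜 polyTimeComputable_doubleAccuracy
  refine ⟨𝒜', h𝒜', fun x k hk => ?_⟩
  have h2k : 0 < 2 * k := by omega
  rw [hrun, doubleAccuracy_boolPair]
  -- the three distributions on input `⟨x, 1^{2k}⟩`
  set pF := (F.kernel O (boolPair x (unaryEncodeNat (2 * k)))).map post with hpF
  set pA := PMF.map (fun o => o.getD [])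
    (𝒜.outputPMF (Oracle.ofLanguage O) (boolPair x (unaryEncodeNat (2 * k)))) with hpA
  have h₁ : pA.tvDist pF ≤ 1 / ((2 * k : ℕ) : ℝ) := by
    rw [PMF.tvDist_comm]
    exact hsim O hq x (2 * k) h2k
  have h₂ : pF.tvDist (S x) ≤ 1 / ((2 * k : ℕ) : ℝ) := hacc x (2 * k) h2k
  have htri : pA.tvDist (S x) ≤ pA.tvDist pF + pF.tvDist (S x) :=
    PMF.tvDist_triangle_holds pA pF (S x)
  have hhalf : 1 / ((2 * k : ℕ) : ℝ) + 1 / ((2 * k : ℕ) : ℝ) = 1 / (k : ℝ) := by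
    have hk' : (k : ℝ) ≠ 0 := by exact_mod_cast hk.ne'
    push_cast
    field_simp
    ring
  calc pA.tvDist (S x) ≤ pA.tvDist pF + pF.tvDist (S x) := htri
    _ ≤ 1 / ((2 * k : ℕ) : ℝ) + 1 / ((2 * k : ℕ) : ℝ) := add_le_add h₁ h₂
    _ = 1 / (k : ℝ) := hhalf

/-- **Thm. 8.1 from its parts**: the printed inclusion `SampBQP^O ⊆ SampBPP^O`, the trivial
inclusion `SampBPP^A ⊆ SampBQP^A` (`SampPRel_subset_SampBQPRel`), `BPP^A ⊆ BQP^A` (the tree fact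
`Literature.Computability.QuantumComplexity.BPPRel_ofLanguage_subset_BQPRel`) and the
sampling-to-language bridge give both printed conclusions as equalities.
[cite: AaronsonChen2017, Thm. 8.1 (p. 32)] -/
theorem aaronsonChen2017_thm81_of_parts (h₁ : aaronsonChen2017_thm81_sampBQP_subset)
    (h₂ : SampPRel_subset_SampBQPRel) (h₃ : BPPRel_ofLanguage_subset_BQPRel)
    (h₄ : BQPRel_subset_BPPRel_of_sampBQPRel_subset) : aaronsonChen2017_thm81 := by
  intro hS hNP O hO
  have hsub := h₁ hS hNP O hO
  exact ⟨Set.Subset.antisymm (h₂ O) hsub, Set.Subset.antisymm (h₃ O) (h₄ O hsub)⟩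

/-- Thm. 8.1 with Lemma 8.2 fed in for the printed inclusion.
[cite: AaronsonChen2017, Thm. 8.1 and Lemma 8.2 (p. 32)] -/
theorem aaronsonChen2017_thm81_of_lem82 (h82 : aaronsonChen2017_lem82) (h₂ : SampPRel_subset_SampBQPRel) (h₃ : BPPRel_ofLanguage_subset_BQPRel)
    (h₄ : BQPRel_subset_BPPRel_of_sampBQPRel_subset) : aaronsonChen2017_thm81 :=
  aaronsonChen2017_thm81_of_parts (aaronsonChen2017_thm81_sampBQP_subset_of_lem82 h82) h₂ h₃ h₄

/-! ### The assembly -/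

/-- **`PPolyOracles` from its parts**: the barrier fact of the entry file from the leaves of this
decomposition (Thm. 7.6: Lemma 7.4 — as the printed implication `OWFExist → PRFExist ∧ PRPExist`,
cf. `aaronsonChen2017_lem74` — and the §7.2–7.3 fact; Thm. 8.1: the printed inclusion and the
three model bridges). [cite: AaronsonChen2017, Thm. 7.6 and Thm. 8.1] -/
theorem PPolyOracles_of_parts (h74 : Summit.PneNP.PneNP.OWFExist → PRFExist ∧ PRPExist)
    (h76 : aaronsonChen2017_thm76_of_prp)
    (h81 : aaronsonChen2017_thm81_sampBQP_subset) (h₂ : SampPRel_subset_SampBQPRel)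
    (h₃ : BPPRel_ofLanguage_subset_BQPRel) (h₄ : BQPRel_subset_BPPRel_of_sampBQPRel_subset) :
    PPolyOracles :=
  ⟨aaronsonChen2017_thm76_of_parts h74 h76, aaronsonChen2017_thm81_of_parts h81 h₂ h₃ h₄⟩

/-- The same with every leaf spelled out down to the tree's crypto facts and Lemma 8.2: the
eight remaining hypotheses of `PPolyOracles_holds` (module docstring, "What remains").
[cite: AaronsonChen2017, Thm. 7.6, Thm. 8.1, Lemma 7.4, Lemma 8.2] -/
theorem PPolyOracles_of_leaves (hHILL : PRGExist_iff_OWFExist) (hGGM : PRFExist_of_PRGExist)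
    (hLR : PRPExist_of_PRFExist) (h76 : aaronsonChen2017_thm76_of_prp)
    (h82 : aaronsonChen2017_lem82) (h₂ : SampPRel_subset_SampBQPRel)
    (h₃ : BPPRel_ofLanguage_subset_BQPRel) (h₄ : BQPRel_subset_BPPRel_of_sampBQPRel_subset) :
    PPolyOracles :=
  ⟨aaronsonChen2017_thm76_of_parts' hHILL hGGM hLR h76,
    aaronsonChen2017_thm81_of_lem82 h82 h₂ h₃ h₄⟩

/-! ### Revision 2: the sampling form of the technique class (`PPolyOracleSamplingSeparation`); Revision 5: the named fact `aaronsonChen2017_thm76_samp` merged back into `aaronsonChen2017_thm76` -/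

/-- **A language separation relative to `O` is a sampling separation relative to `O`.** If
`SampBPP^O = SampBQP^O` then `SampBQP^O ⊆ SampBPP^O`, hence `BQP^O ⊆ BPP^O` by the
sampling-to-language bridge `BQPRel_subset_BPPRel_of_sampBQPRel_subset` (Thm. 8.1's "and
consequently"), and with `BPP^O ⊆ BQP^O` (`BPPRel_ofLanguage_subset_BQPRel`, Bernstein–Vazirani)
the language classes coincide; contrapose. Over the entry file's two technique classes.
[cite: AaronsonChen2017, Thm. 8.1 ("and consequently BPP^O = BQP^O", p. 32)] -/
theorem pPolyOracleSamplingSeparation_of_pPolyOracleSeparation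
    (h₃ : BPPRel_ofLanguage_subset_BQPRel) (h₄ : BQPRel_subset_BPPRel_of_sampBQPRel_subset)
    (hsep : PPolyOracleSeparation) : PPolyOracleSamplingSeparation := by
  obtain ⟨O, hO, hne⟩ := hsep
  refine ⟨O, hO, fun heq => hne ?_⟩
  have hsub : SampBQPRel O ⊆ SampPRel (Oracle.ofLanguage O) := fun D hD => by
    rw [heq]
    exact hD
  exact Set.Subset.antisymm (h₃ O) (h₄ O hsub)

/-- **Aaronson–Chen 2017, Thm. 7.6 in sampling form, from its parts** (§1, p. 10: "Relative to
some efficiently computable oracle, we can prove `SampBPP ≠ SampBQP`, but only under a weak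
computational assumption, like the existence of one-way functions"): Thm. 7.6 (language form,
`aaronsonChen2017_thm76`, p. 30) and the two bridges give, under the tree's `OWFExist`, an oracle
language `O ∈ P/poly` with `SampBPP^O ≠ SampBQP^O`, i.e. the entry file's technique class
`PPolyOracleSamplingSeparation`. (Revision 5: this printed conditional is a THEOREM over the
language-form fact, conclusion stated unfolded; the separate named fact
`aaronsonChen2017_thm76_samp` that used to restate it is retired — its proof obligation was exactly
`aaronsonChen2017_thm76_holds`. With both bridges discharged in the tree the hypotheses `h₃`, `h₄`
disappear: `pPolyOracleSamplingSeparation_of_thm76`, `PPolyOraclesBridgesProofs.lean`.)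
[cite: AaronsonChen2017, §1 (p. 10) and Thm. 7.6 (p. 30)] -/
theorem aaronsonChen2017_thm76_samp_of_parts (h76 : aaronsonChen2017_thm76)
    (h₃ : BPPRel_ofLanguage_subset_BQPRel) (h₄ : BQPRel_subset_BPPRel_of_sampBQPRel_subset)
    (howf : Summit.PneNP.PneNP.OWFExist) : PPolyOracleSamplingSeparation :=
  pPolyOracleSamplingSeparation_of_pPolyOracleSeparation h₃ h₄ (h76 howf)

/-- **Thm. 7.6 in sampling form from the leaves** of this decomposition: HILL, GGM, Luby–Rackoff,
the §7.2–7.3 fact and the two bridges. [cite: AaronsonChen2017, Lemma 7.4, Thm. 7.6 (pp. 29–30) and §1 (p. 10)] -/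
theorem aaronsonChen2017_thm76_samp_of_leaves (hHILL : PRGExist_iff_OWFExist)
    (hGGM : PRFExist_of_PRGExist) (hLR : PRPExist_of_PRFExist)
    (h76 : aaronsonChen2017_thm76_of_prp) (h₃ : BPPRel_ofLanguage_subset_BQPRel)
    (h₄ : BQPRel_subset_BPPRel_of_sampBQPRel_subset) (howf : Summit.PneNP.PneNP.OWFExist) :
    PPolyOracleSamplingSeparation :=
  aaronsonChen2017_thm76_samp_of_parts (aaronsonChen2017_thm76_of_parts' hHILL hGGM hLR h76) h₃ h₄ howf

/-- **One-way functions suffice for a `P/poly`-oracle SAMPLING separation** (the evasion of the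
entry file's barrier block, sampling form): under the barrier fact `PPolyOracles` and the two
bridges, `OWFExist` gives `PPolyOracleSamplingSeparation` — the strongest thing the tree can say
towards `PPolyOracleSamplingSeparation_holds` (bridge-free form:
`pPolyOracleSamplingSeparation_of_PPolyOracles`, `PPolyOraclesBridgesProofs.lean`).
[cite: AaronsonChen2017, §1 (p. 10) and Thm. 7.6 (p. 30)] -/
theorem pPolyOracleSamplingSeparation_of_owf (h : PPolyOracles)
    (h₃ : BPPRel_ofLanguage_subset_BQPRel) (h₄ : BQPRel_subset_BPPRel_of_sampBQPRel_subset)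
    (howf : Summit.PneNP.PneNP.OWFExist) : PPolyOracleSamplingSeparation :=
  aaronsonChen2017_thm76_samp_of_parts h.thm76 h₃ h₄ howf

/-- **The technique class is refuted under the collapse hypotheses of Thm. 8.1**: if
`SampBPP = SampBQP` and `NP ⊆ BPP` then no `O ∈ P/poly` separates the sampling classes
(contrapositive packaging of the entry file's `not_collapse_of_pPolyOracleSamplingSeparation`).
[cite: AaronsonChen2017, Thm. 8.1 (p. 32)] -/
theorem not_pPolyOracleSamplingSeparation_of_collapse (h : aaronsonChen2017_thm81)
    (hS : SampP = SampBQP) (hNP : NP ⊆ BPP) : ¬ PPolyOracleSamplingSeparation :=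
  fun hsep => not_collapse_of_pPolyOracleSamplingSeparation h hsep ⟨hS, hNP⟩

/-- **What an unconditional proof of the technique class would prove**: under Thm. 8.1, a
`P/poly`-oracle sampling separation yields `SampBPP ≠ SampBQP ∨ NP ⊄ BPP` ("we need to assume
something about the unrelativized world: either `SampBPP ≠ SampBQP` (in which case we wouldn't
even need an oracle), or else `NP ⊄ BPP`"). [cite: AaronsonChen2017, §1 (p. 9) and Thm. 8.1 (p. 32)] -/
theorem sampP_ne_or_NP_not_subset_of_samplingSeparation (h : aaronsonChen2017_thm81)
    (hsep : PPolyOracleSamplingSeparation) : SampP ≠ SampBQP ∨ ¬ NP ⊆ BPP := by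
  by_cases hS : SampP = SampBQP
  · exact Or.inr fun hNP => not_collapse_of_pPolyOracleSamplingSeparation h hsep ⟨hS, hNP⟩
  · exact Or.inl hS

/-- **Reformulation through the trivial inclusion**: given `SampBPP^A ⊆ SampBQP^A` for all `A`
(`SampPRel_subset_SampBQPRel`), the technique class says exactly that `SampBQP^O ⊆ SampBPP^O`
FAILS for some `O ∈ P/poly` — the negation, oracle by oracle, of Thm. 8.1's printed conclusion
"Hence `SampBQP^O ⊆ SampBPP^O`". [cite: AaronsonChen2017, Thm. 8.1 (proof, p. 32)] -/
theorem pPolyOracleSamplingSeparation_iff_not_subset (h₂ : SampPRel_subset_SampBQPRel) :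
    PPolyOracleSamplingSeparation ↔
      ∃ O : Language Bool, O ∈ PPoly ∧ ¬ SampBQPRel O ⊆ SampPRel (Oracle.ofLanguage O) := by
  refine exists_congr fun O => and_congr_right fun _ => ⟨fun hne hsub => ?_, fun hns heq => ?_⟩
  · exact hne (Set.Subset.antisymm (h₂ O) hsub)
  · refine hns fun D hD => ?_
    rw [heq]
    exact hD

/-- Hence, under the collapse hypotheses and Thm. 8.1's printed inclusion alone (no bridges),
the technique class fails. [cite: AaronsonChen2017, Thm. 8.1 (proof, p. 32)] -/
theorem not_pPolyOracleSamplingSeparation_of_sampBQP_subset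
    (h₁ : aaronsonChen2017_thm81_sampBQP_subset) (h₂ : SampPRel_subset_SampBQPRel)
    (hS : SampP = SampBQP) (hNP : NP ⊆ BPP) : ¬ PPolyOracleSamplingSeparation := by
  rw [pPolyOracleSamplingSeparation_iff_not_subset h₂]
  rintro ⟨O, hO, hns⟩
  exact hns (h₁ hS hNP O hO)

/-! ### Revision 3: Lemma 7.4 with the Luby–Rackoff leaf opened (provefact decomposition) -/

/-- **Lemma 7.4 from HILL, GGM and the Luby–Rackoff security clause.** The paper's citation list
for Lemma 7.4 is [HILL] (`OWF → PRG`, tree fact `PRGExist_iff_OWFExist`), [GGM] (`PRG → PRF`,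
`PRFExist_of_PRGExist`) and [Luby–Rackoff] (`PRF → PRP`); the last is now the PROVED reduction
`PRPExist_of_PRFExist_of_feistel3` of `Cryptography/LubyRackoff.lean` (Goldreich's Construction
3.7.6 `DES³_F`, permutation and efficiency clauses of Thm. 3.7.7 proved there) from the security
clause `LubyRackoff1988_feistel3` alone. [cite: AaronsonChen2017, Lemma 7.4 (p. 29)] -/
theorem aaronsonChen2017_lem74_of_parts_feistel3 (h₁ : PRGExist_iff_OWFExist)
    (h₂ : PRFExist_of_PRGExist) (h₃ : LubyRackoff1988_feistel3) : Summit.PneNP.PneNP.OWFExist → PRFExist ∧ PRPExist :=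
  aaronsonChen2017_lem74 h₁ h₂ (PRPExist_of_PRFExist_of_feistel3 h₃)

/-- Hence the barrier fact `PPolyOracles` with the Luby–Rackoff leaf replaced by the security
clause of the explicit Feistel construction (the other seven leaves as in
`PPolyOracles_of_leaves`). [cite: AaronsonChen2017, Thm. 7.6, Thm. 8.1, Lemma 7.4, Lemma 8.2] -/
theorem PPolyOracles_of_leaves_feistel3 (hHILL : PRGExist_iff_OWFExist) (hGGM : PRFExist_of_PRGExist)
    (hLR : LubyRackoff1988_feistel3) (h76 : aaronsonChen2017_thm76_of_prp)
    (h82 : aaronsonChen2017_lem82) (h₂ : SampPRel_subset_SampBQPRel)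
    (h₃ : BPPRel_ofLanguage_subset_BQPRel) (h₄ : BQPRel_subset_BPPRel_of_sampBQPRel_subset) :
    PPolyOracles :=
  PPolyOracles_of_leaves hHILL hGGM (PRPExist_of_PRFExist_of_feistel3 hLR) h76 h82 h₂ h₃ h₄

end Literature.Barriers.QuantumAdvantage

end
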